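import Literature.Probability.Percolation.KSZTransversal
import Literature.Probability.Percolation.ArmSeparationTrapezoid
import HarnessLib

/-!
# Rerouting any number of disjoint open sets along the greedy lowest crossings (KSZ)

Topic: Probability / Percolation; family `crit-perc` (site percolation on the triangular lattice
`𝕋 = triGraph`). The deterministic rerouting step of Kesten–Sidoravicius–Zhang for an ARBITRARY
number of disjoint occupied crossings (KSZ 1998, Appendix §7, (7.9) and p. 27), in the abstract
`JDomain` setting of `TriLowestCrossing.lean`, on top of the closed transversal of
`KSZTransversal.lean`; the same-colour multiplicity-`m` step of Nolin's arm-separation theorem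
(Nolin 2008, Thm. 11, proof of Lemma 15 [arXiv 0711.4948: Thm. 10, Lemma 14]) towards
`Literature.Probability.Percolation.Nolin2008_prop17_quasiMult` (`FiveArmExponentFacts.lean`).

> "(7.9) if `s_1, …, s_p` are disjoint occupied left-right crossings of `S_R`, then there exist
> `r_{i_1}, …, r_{i_p}` with `i_1, …, i_p` distinct and `p` disjoint occupied left-right crossings
> of `S_R`, `t_1, …, t_p`, such that `t_q` has the same initial point as `s_q` on the left edge of
> `S_R`, and such that `t_q` has the same endpoint as `r_{i_q}` on the right edge of `S_R`. …
> `τ` separates the left edge of `S_R` from its right edge, so that each `s_q` must intersect `τ`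
> in some point. Since `s_q` is occupied this intersection must be at one of the `v_i`. Let the
> first intersection of `s_q` with `τ` be at `v_{i_q}`. These `v_{i_q}` must be distinct for
> different `q`, because the `s_q` are disjoint. Now take for `t_q` the first part of `s_q` …
> till `v_{i_q}`, followed by the part of `r_{i_q}` from `v_{i_q}` till its endpoint … the `t_q`
> for different `q` are disjoint, because the piece of `s_q` till it reaches `v_{i_q}` lies to the
> 'left of `τ`' and cannot intersect the piece of some `r_j` with `j ≠ i_q` from `v_j` to
> `a(r_j)`, because this lies to the 'right of `τ`'." (KSZ 1998, p. 27)

We work with SETS of sites rather than self-avoiding paths (the members of the family to be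
rerouted are arbitrary `𝕋`-connected open sets containing a start site outside the domain, e.g.
whole arms of an arm event together with pieces of crossings acquired in earlier rerouting
steps), so that the output family has the same shape as the input family and the step can be
iterated over several domains.

## Main definitions (namespace `JDomain`, `τ : Q.Transversal ω`)

* `JDomain.Transversal Q ω` — the data of a closed transversal of `ω` (`exists_transversal`):
  a set `T ⊆ D` carrying a `Bt–Tp` path, whose open sites are the junctions `jn u ∈ c_u`, one on
  each term `c_u` of the exploration sequence `lowestSeq ω`; `nonempty_transversal`.
* `τ.IsLeft x` / `τ.IsRight x` — `x` is joined to `F` / to `J` inside `D ∖ T`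
  ("left of `τ`" / "right of `τ`"); they exclude each other and are never adjacent
  (`not_isRight_of_isLeft`, `not_adj_of_isLeft_of_isRight`).
* `τ.comp A a` — the sites of `A` joined to the start `a` inside `A ∖ T` ("the first part of
  `s_q` till `v_{i_q}`", for a set).
* `τ.firstTerm A a` — the least index `u` of a term whose junction lies in `A` next to
  `τ.comp A a` (`none` if there is none); `τ.tail u` — the junction of the term `u` together
  with the sites of `c_u` right of `τ` ("the part of `r_{i_q}` from `v_{i_q}` till its
  endpoint"); `τ.reroute A a = τ.comp A a ∪ τ.tail u` (`u = firstTerm`; just `comp = A` if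
  `A` misses `T`).

## Main results

* `pathIn_reroute` — the rerouted set is `𝕋`-connected from `a`; `reroute_subset_union`,
  `reroute_subset_of_subset` (open), `tip_mem_reroute` (it contains the tip `z_u ∈ J` of its
  term), `reroute_inter_T_subset` (it meets `T` only at the junction `jn u`),
  `reroute_eq_self` (members missing `T` are untouched), `firstTerm_ne_none_of_meets_J`
  (a member reaching `J` is rerouted).
* `isLeft_of_mem_comp` — **left of `τ`**: a site of `comp A a` in `D` is joined to `F` inside
  `D ∖ T`, provided `A` enters `D` only through `F` (`a ∉ D`).
* `disjoint_reroute` — **KSZ (7.9)**: the reroutings of two disjoint open members entering `D`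
  only through `F` are disjoint; `firstTerm_ne_of_disjoint` — they use distinct terms.
* `mem_trapI_of_adj_not_mem` — for the trapezoid `trapDomain M` behind side `0` of `∂Λ_{2M}`, a
  set of sites of `Λ_{2M}` enters `trapD M` only through `trapI M` (the hypothesis `hentry`).

## References

* H. Kesten, V. Sidoravicius, Y. Zhang, *Almost all words are seen in critical site percolation
  on the triangular lattice*, Electron. J. Probab. 3 (1998), paper 10, Appendix §7, (7.9)–(7.10),
  p. 27. [KestenSidoraviciusZhang1998]
* P. Nolin, *Near-critical percolation in two dimensions*, Electron. J. Probab. 13 (2008), §4.4,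
  Lemma 15, last paragraph [arXiv 0711.4948: Lemma 14]. [Nolin2008]

Mathlib search: no percolation notions in Mathlib; `Nat.find`, `Option.elim`. Tree:
`exists_transversal`, `not_pathIn_sdiff_of_transversal`, `exists_first_visit_of_transversal`
(`KSZTransversal.lean`), `lowestSeq_disjoint_of_lt`, `isCrossing_of_lowestSeq`
(`TriLowestCrossing.lean`), `PathIn.exit`, `PathIn.last_exit`, `PathIn.exists_support`,
`trapDomain`, `mem_trapD_iff_triNorm`, `triGraph_adj_coord`.
-/

noncomputable section

namespace Literature.Probability.Percolation

open LatticeModels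

namespace JDomain

variable {Q : JDomain} {ω : Set (Site 2)}

/-! ### Transversals -/

/-- **A closed transversal of `ω`** (KSZ 1998, App. (7.10)): a set `T ⊆ D` carrying a `𝕋`-path
from `Bt` to `Tp`, and junctions `jn u`, such that every open site of `T` is the junction of a
term of the exploration sequence of `ω` and the junction of every term lies on the term and on
`T`. [cite: KestenSidoraviciusZhang1998, App. §7 (7.10) p. 27] -/
structure Transversal (Q : JDomain) (ω : Set (Site 2)) where
  /-- the sites of the transversal -/
  T : Set (Site 2)
  /-- the junctions -/
  jn : ℕ → Site 2
  /-- the start, on `Bt` -/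
  s : Site 2
  /-- the end, on `Tp` -/
  e : Site 2
  T_subset : T ⊆ ↑Q.D
  s_mem : s ∈ Q.Bt
  e_mem : e ∈ Q.Tp
  path : PathIn triGraph T s e
  eq_jn_of_mem : ∀ y ∈ T, y ∈ ω → ∃ u c z, Q.lowestSeq ω u = some (c, z) ∧ y = jn u
  jn_mem : ∀ u c z, Q.lowestSeq ω u = some (c, z) → jn u ∈ c ∧ jn u ∈ T

/-- **Transversals exist** (under `CutProp`, `DualProp`; the exploration sequence stops after at
most `#D + 1` steps). [cite: KestenSidoraviciusZhang1998, App. §7 (7.10) p. 27] -/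
theorem nonempty_transversal (hcut : Q.CutProp) (hdual : Q.DualProp) (ω : Set (Site 2)) :
    Nonempty (Q.Transversal ω) := by
  obtain ⟨T, v, hTD, ⟨s, hs, e, he, hp⟩, hopen, hterm⟩ :=
    exists_transversal hcut hdual (lowestSeq_eq_none_of_card_lt (ω := ω) hcut (Nat.lt_succ_self Q.D.card))
  exact ⟨⟨T, v, s, e, hTD, hs, he, hp, hopen, hterm⟩⟩

namespace Transversal

variable (τ : Q.Transversal ω)

/-- Junctions of distinct terms are distinct (the terms are disjoint). [cite: KestenSidoraviciusZhang1998, App. §7 (7.10) p. 27] -/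
theorem eq_of_jn_eq (hcut : Q.CutProp) {u u' : ℕ} {c c' : Finset (Site 2)} {z z' : Site 2}
    (hu : Q.lowestSeq ω u = some (c, z)) (hu' : Q.lowestSeq ω u' = some (c', z'))
    (h : τ.jn u = τ.jn u') : u = u' := by
  by_contra hne
  have h1 := (τ.jn_mem u c z hu).1
  have h2 := (τ.jn_mem u' c' z' hu').1
  rcases Nat.lt_or_gt_of_ne hne with hlt | hlt
  · exact Finset.disjoint_left.1 (lowestSeq_disjoint_of_lt hcut hlt hu hu') h1 (h ▸ h2)
  · exact Finset.disjoint_left.1 (lowestSeq_disjoint_of_lt hcut hlt hu' hu) h2 (h ▸ h1)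

/-- **A term meets the transversal only at its junction.** [cite: KestenSidoraviciusZhang1998, App. §7 (7.10) p. 27] -/
theorem eq_jn_of_mem_term (hcut : Q.CutProp) {u : ℕ} {c : Finset (Site 2)} {z y : Site 2}
    (hu : Q.lowestSeq ω u = some (c, z)) (hy : y ∈ c) (hyT : y ∈ τ.T) : y = τ.jn u := by
  have hyω : y ∈ ω := (isCrossing_of_lowestSeq hu).2 (Finset.mem_coe.2 hy)
  obtain ⟨u', c', z', hu', rfl⟩ := τ.eq_jn_of_mem y hyT hyω
  have h2 := (τ.jn_mem u' c' z' hu').1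
  by_contra hne
  have hne' : u' ≠ u := fun e => hne (e ▸ rfl)
  rcases Nat.lt_or_gt_of_ne hne' with hlt | hlt
  · exact Finset.disjoint_left.1 (lowestSeq_disjoint_of_lt hcut hlt hu' hu) h2 hy
  · exact Finset.disjoint_left.1 (lowestSeq_disjoint_of_lt hcut hlt hu hu') hy h2

/-- A site of a term other than its junction is a site of `D ∖ T`. [folklore] -/
theorem mem_sdiff_of_mem_term (hcut : Q.CutProp) {u : ℕ} {c : Finset (Site 2)} {z y : Site 2}
    (hu : Q.lowestSeq ω u = some (c, z)) (hy : y ∈ c) (hne : y ≠ τ.jn u) :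
    y ∈ ((Q.D : Set (Site 2)) \ τ.T) :=
  ⟨Finset.mem_coe.2 ((isCrossing_of_lowestSeq hu).1.subset hy), fun hyT => hne (τ.eq_jn_of_mem_term hcut hu hy hyT)⟩

/-! ### Left and right of the transversal -/

/-- `x` lies **left of `τ`**: it is joined to the start set `F` inside `D ∖ T`. [cite: KestenSidoraviciusZhang1998, App. §7 p. 27] -/
def IsLeft (x : Site 2) : Prop := ∃ f ∈ Q.F, PathIn triGraph ((Q.D : Set (Site 2)) \ τ.T) f x

/-- `x` lies **right of `τ`**: it is joined to the tip arc `J` inside `D ∖ T`. [cite: KestenSidoraviciusZhang1998, App. §7 p. 27] -/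
def IsRight (x : Site 2) : Prop := ∃ j ∈ Q.J, PathIn triGraph ((Q.D : Set (Site 2)) \ τ.T) x j

/-- **Left and right exclude each other.** [cite: KestenSidoraviciusZhang1998, App. §7 p. 27] -/
theorem not_isRight_of_isLeft (hcut : Q.CutProp) {x : Site 2} (hl : τ.IsLeft x) : ¬ τ.IsRight x := by
  rintro ⟨j, hj, hp⟩
  obtain ⟨f, hf, hq⟩ := hl
  exact not_pathIn_sdiff_of_transversal hcut τ.T_subset τ.s_mem τ.e_mem τ.path hf hj (hq.trans hp)

/-- **Left and right sites are never adjacent.** [cite: KestenSidoraviciusZhang1998, App. §7 p. 27] -/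
theorem not_adj_of_isLeft_of_isRight (hcut : Q.CutProp) {x y : Site 2} (hl : τ.IsLeft x) (hr : τ.IsRight y) :
    ¬ triGraph.Adj x y := by
  intro hxy
  obtain ⟨f, hf, hq⟩ := hl
  obtain ⟨j, hj, hp⟩ := hr
  exact not_pathIn_sdiff_of_transversal hcut τ.T_subset τ.s_mem τ.e_mem τ.path hf hj
    ((hq.tail hxy hp.left_mem).trans hp)

/-- Right is inherited backwards along paths of `D ∖ T`. [folklore] -/
theorem isRight_of_pathIn {x y : Site 2} (hp : PathIn triGraph ((Q.D : Set (Site 2)) \ τ.T) x y)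
    (hy : τ.IsRight y) : τ.IsRight x := by
  obtain ⟨j, hj, hq⟩ := hy
  exact ⟨j, hj, hp.trans hq⟩

/-- Left is inherited forwards along paths of `D ∖ T`. [folklore] -/
theorem isLeft_of_pathIn {x y : Site 2} (hp : PathIn triGraph ((Q.D : Set (Site 2)) \ τ.T) x y)
    (hx : τ.IsLeft x) : τ.IsLeft y := by
  obtain ⟨f, hf, hq⟩ := hx
  exact ⟨f, hf, hq.trans hp⟩

/-- A site of `J` off `T` is right of `τ`. [folklore] -/
theorem isRight_of_mem_J {j : Site 2} (hj : j ∈ Q.J) (hjT : j ∉ τ.T) : τ.IsRight j :=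
  ⟨j, hj, PathIn.refl ⟨Finset.mem_coe.2 (Q.J_subset hj), hjT⟩⟩

/-! ### The component of the start, the tail of a term, the rerouted set -/

/-- **The first part of a member**: the sites of `A` joined to the start `a` inside `A ∖ T`. [cite: KestenSidoraviciusZhang1998, App. §7 (7.9) p. 27] -/
def comp (A : Set (Site 2)) (a : Site 2) : Set (Site 2) := {x | PathIn triGraph (A \ τ.T) a x}

/-- **The tail of the term `u`**: its junction together with the sites of the term right of `τ`
("the part of `r_{i_q}` from `v_{i_q}` till its endpoint"). [cite: KestenSidoraviciusZhang1998, App. §7 (7.9) p. 27] -/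
def tail (u : ℕ) : Set (Site 2) :=
  {τ.jn u} ∪ {y | ∃ c z, Q.lowestSeq ω u = some (c, z) ∧ y ∈ c ∧ τ.IsRight y}

open Classical in
/-- **The term onto which a member is rerouted**: the least index of a term whose junction lies
in `A` next to `comp A a` (`none` if no junction of `A` is next to `comp A a`). [cite: KestenSidoraviciusZhang1998, App. §7 (7.9) p. 27] -/
def firstTerm (A : Set (Site 2)) (a : Site 2) : Option ℕ :=
  if h : ∃ u, (∃ p, Q.lowestSeq ω u = some p) ∧ τ.jn u ∈ A ∧ ∃ x ∈ τ.comp A a, triGraph.Adj x (τ.jn u)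
  then some (Nat.find h) else none

/-- **The rerouted member**: its first part, followed by the tail of its term. [cite: KestenSidoraviciusZhang1998, App. §7 (7.9) p. 27] -/
def reroute (A : Set (Site 2)) (a : Site 2) : Set (Site 2) :=
  τ.comp A a ∪ (τ.firstTerm A a).elim ∅ τ.tail

variable {τ}

variable {A B : Set (Site 2)} {a b x y : Site 2}

/-- `comp A a ⊆ A`. [folklore] -/
theorem comp_subset (hx : x ∈ τ.comp A a) : x ∈ A := (PathIn.right_mem hx).1

/-- `comp A a` misses `T`. [folklore] -/
theorem not_mem_T_of_mem_comp (hx : x ∈ τ.comp A a) : x ∉ τ.T := (PathIn.right_mem hx).2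

/-- The start lies in its component. [folklore] -/
theorem start_mem_comp (ha : a ∈ A) (haT : a ∉ τ.T) : a ∈ τ.comp A a := PathIn.refl ⟨ha, haT⟩

/-- `comp A a` is `𝕋`-connected from `a` inside itself. [folklore] -/
theorem pathIn_comp (hx : x ∈ τ.comp A a) : PathIn triGraph (τ.comp A a) a x := by
  obtain ⟨S, hSA, hS, hSall⟩ := PathIn.exists_support hx
  exact hS.mono fun w hw => show PathIn triGraph (A \ τ.T) a w from (hSall w hw).mono hSA

/-- `comp A a` is closed under steps of `A ∖ T`. [folklore] -/
theorem mem_comp_of_adj (hx : x ∈ τ.comp A a) (hy : y ∈ A) (hyT : y ∉ τ.T) (hxy : triGraph.Adj x y) :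
    y ∈ τ.comp A a :=
  PathIn.tail hx hxy ⟨hy, hyT⟩

/-- The specification of `firstTerm = some u`. [folklore] -/
theorem firstTerm_spec {u : ℕ} (h : τ.firstTerm A a = some u) :
    (∃ p, Q.lowestSeq ω u = some p) ∧ τ.jn u ∈ A ∧ ∃ x ∈ τ.comp A a, triGraph.Adj x (τ.jn u) := by
  classical
  unfold firstTerm at h
  split_ifs at h with h'
  · have := Nat.find_spec h'
    rw [Option.some.inj h] at this
    exact this

/-- The specification of `firstTerm = none`. [folklore] -/
theorem firstTerm_eq_none_iff :
    τ.firstTerm A a = none ↔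
      ∀ u, (∃ p, Q.lowestSeq ω u = some p) → τ.jn u ∈ A → ∀ x ∈ τ.comp A a, ¬ triGraph.Adj x (τ.jn u) := by
  classical
  by_cases h' : ∃ u, (∃ p, Q.lowestSeq ω u = some p) ∧ τ.jn u ∈ A ∧ ∃ x ∈ τ.comp A a, triGraph.Adj x (τ.jn u)
  · rw [firstTerm, dif_pos h']
    refine ⟨fun h => absurd h (Option.some_ne_none _), fun hall => ?_⟩
    obtain ⟨u, hu, hj, x, hx, hadj⟩ := id h'
    exact absurd hadj (hall u hu hj x hx)
  · rw [firstTerm, dif_neg h']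
    exact ⟨fun _ u hu hj x hx hadj => h' ⟨u, hu, hj, x, hx, hadj⟩, fun _ => rfl⟩

/-- **A member meeting `T` is rerouted** (when it is open and `𝕋`-connected from a start off
`T`): follow a path of `A` from `a` to a site of `T`; its first site on `T` is open, hence a
junction, next to `comp A a`. [cite: KestenSidoraviciusZhang1998, App. §7 (7.9) p. 27] -/
theorem firstTerm_ne_none_of_mem (hAω : A ⊆ ω) (hconn : ∀ x ∈ A, PathIn triGraph A a x)
    (haT : a ∉ τ.T) (hy : y ∈ A) (hyT : y ∈ τ.T) : τ.firstTerm A a ≠ none := by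
  intro hnone
  obtain ⟨p, q, hpT, hqT, hqA, hpq, hpath⟩ :=
    (hconn y hy).exit (R := {w | w ∉ τ.T}) haT (fun h => h hyT)
  have hqT' : q ∈ τ.T := not_not.1 hqT
  obtain ⟨u, c, z, hu, rfl⟩ := τ.eq_jn_of_mem q hqT' (hAω hqA)
  have hp : p ∈ τ.comp A a := hpath.mono fun w hw => ⟨hw.2, hw.1⟩
  exact firstTerm_eq_none_iff.1 hnone u ⟨(c, z), hu⟩ hqA p hp hpq

/-- A member missing `T` is not rerouted. [folklore] -/
theorem firstTerm_eq_none_of_disjoint (h : Disjoint A τ.T) : τ.firstTerm A a = none := by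
  refine firstTerm_eq_none_iff.2 fun u hu hj x _ _ => ?_
  obtain ⟨⟨c, z⟩, hu⟩ := hu
  exact Set.disjoint_left.1 h hj (τ.jn_mem u c z hu).2

/-- A member missing `T` equals its first part (when `𝕋`-connected from `a`). [folklore] -/
theorem comp_eq_self (h : Disjoint A τ.T) (hconn : ∀ x ∈ A, PathIn triGraph A a x) : τ.comp A a = A := by
  refine Set.Subset.antisymm (fun x hx => comp_subset hx) fun x hx => ?_
  exact (hconn x hx).mono fun w hw => ⟨hw, Set.disjoint_left.1 h hw⟩

/-- **Untouched members**: a member missing `T` is rerouted onto itself. [cite: KestenSidoraviciusZhang1998, App. §7 (7.9) p. 27] -/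
theorem reroute_eq_self (h : Disjoint A τ.T) (hconn : ∀ x ∈ A, PathIn triGraph A a x) : τ.reroute A a = A := by
  rw [reroute, firstTerm_eq_none_of_disjoint h, comp_eq_self h hconn]
  simp

/-- The first part is part of the rerouted member. [folklore] -/
theorem comp_subset_reroute : τ.comp A a ⊆ τ.reroute A a := Set.subset_union_left

/-- The tail of the chosen term is part of the rerouted member. [folklore] -/
theorem tail_subset_reroute {u : ℕ} (h : τ.firstTerm A a = some u) : τ.tail u ⊆ τ.reroute A a := by
  intro y hy
  rw [reroute, h]
  exact Set.mem_union_right _ hy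

/-- Membership in the rerouted member, when a term is chosen. [folklore] -/
theorem mem_reroute_iff {u : ℕ} (h : τ.firstTerm A a = some u) :
    x ∈ τ.reroute A a ↔ x ∈ τ.comp A a ∨ x ∈ τ.tail u := by
  rw [reroute, h]; rfl

/-- Membership in the rerouted member, when no term is chosen. [folklore] -/
theorem mem_reroute_iff_of_none (h : τ.firstTerm A a = none) : x ∈ τ.reroute A a ↔ x ∈ τ.comp A a := by
  rw [reroute, h]; simp

/-- Membership in the tail of an existing term. [folklore] -/
theorem mem_tail_iff {u : ℕ} {c : Finset (Site 2)} {z : Site 2} (hu : Q.lowestSeq ω u = some (c, z)) :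
    y ∈ τ.tail u ↔ y = τ.jn u ∨ (y ∈ c ∧ τ.IsRight y) := by
  simp only [tail, Set.singleton_union, Set.mem_insert_iff, Set.mem_setOf_eq]
  refine or_congr Iff.rfl ⟨?_, fun h => ⟨c, z, hu, h⟩⟩
  rintro ⟨c', z', hu', h⟩
  rw [hu] at hu'
  obtain ⟨rfl, rfl⟩ := Prod.mk.inj (Option.some.inj hu')
  exact h

/-- The tail of an existing term lies on the term. [folklore] -/
theorem tail_subset_term {u : ℕ} {c : Finset (Site 2)} {z : Site 2} (hu : Q.lowestSeq ω u = some (c, z)) :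
    τ.tail u ⊆ ↑c := by
  intro y hy
  rcases (mem_tail_iff hu).1 hy with rfl | ⟨hyc, -⟩
  · exact Finset.mem_coe.2 (τ.jn_mem u c z hu).1
  · exact Finset.mem_coe.2 hyc

/-- **The rerouted member lies in the old member and its term.** [cite: KestenSidoraviciusZhang1998, App. §7 (7.9) p. 27] -/
theorem reroute_subset_union {u : ℕ} {c : Finset (Site 2)} {z : Site 2} (h : τ.firstTerm A a = some u)
    (hu : Q.lowestSeq ω u = some (c, z)) : τ.reroute A a ⊆ A ∪ ↑c := by
  intro y hy
  rcases (mem_reroute_iff h).1 hy with hy | hy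
  · exact Set.mem_union_left _ (comp_subset hy)
  · exact Set.mem_union_right _ (tail_subset_term hu hy)

/-- **The rerouted member of an open member is open.** [cite: KestenSidoraviciusZhang1998, App. §7 (7.9) p. 27] -/
theorem reroute_subset_of_subset (hAω : A ⊆ ω) : τ.reroute A a ⊆ ω := by
  intro y hy
  cases h : τ.firstTerm A a with
  | none => exact hAω (comp_subset ((mem_reroute_iff_of_none h).1 hy))
  | some u =>
    obtain ⟨⟨⟨c, z⟩, hu⟩, -, -⟩ := firstTerm_spec h
    rcases (mem_reroute_iff h).1 hy with hy | hy
    · exact hAω (comp_subset hy)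
    · exact (isCrossing_of_lowestSeq hu).2 (tail_subset_term hu hy)

/-- The start lies in its rerouted member. [folklore] -/
theorem start_mem_reroute (ha : a ∈ A) (haT : a ∉ τ.T) : a ∈ τ.reroute A a :=
  comp_subset_reroute (start_mem_comp ha haT)

/-- The junction of the chosen term lies in the old member. [folklore] -/
theorem jn_mem_of_firstTerm {u : ℕ} (h : τ.firstTerm A a = some u) : τ.jn u ∈ A := (firstTerm_spec h).2.1

/-- The junction of the chosen term lies in the rerouted member. [folklore] -/
theorem jn_mem_reroute {u : ℕ} (h : τ.firstTerm A a = some u) : τ.jn u ∈ τ.reroute A a :=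
  tail_subset_reroute h (Set.mem_union_left _ rfl)

/-- **The rerouted member reaches the tip of its term.** [cite: KestenSidoraviciusZhang1998, App. §7 (7.9) p. 27] -/
theorem tip_mem_reroute (hcut : Q.CutProp) {u : ℕ} {c : Finset (Site 2)} {z : Site 2}
    (h : τ.firstTerm A a = some u) (hu : Q.lowestSeq ω u = some (c, z)) : z ∈ τ.reroute A a := by
  refine tail_subset_reroute h ((mem_tail_iff hu).2 ?_)
  by_cases hz : z = τ.jn u
  · exact Or.inl hz
  · have hc := (isCrossing_of_lowestSeq hu).1
    exact Or.inr ⟨hc.tip_mem, τ.isRight_of_mem_J hc.tip_mem_J (τ.mem_sdiff_of_mem_term hcut hu hc.tip_mem hz).2⟩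

/-- **Every site of the term right of `τ` lies in the rerouted member** (used to attach the
fence of the term). [cite: KestenSidoraviciusZhang1998, App. §7 (7.9) p. 27] -/
theorem mem_reroute_of_isRight {u : ℕ} {c : Finset (Site 2)} {z : Site 2}
    (h : τ.firstTerm A a = some u) (hu : Q.lowestSeq ω u = some (c, z)) (hy : y ∈ c) (hr : τ.IsRight y) :
    y ∈ τ.reroute A a :=
  tail_subset_reroute h ((mem_tail_iff hu).2 (Or.inr ⟨hy, hr⟩))

/-- **The rerouted member meets `T` only at the junction of its term.** [cite: KestenSidoraviciusZhang1998, App. §7 (7.9) p. 27] -/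
theorem reroute_inter_T_subset (hy : y ∈ τ.reroute A a) (hyT : y ∈ τ.T) :
    ∃ u, τ.firstTerm A a = some u ∧ y = τ.jn u := by
  cases h : τ.firstTerm A a with
  | none => exact absurd hyT (not_mem_T_of_mem_comp ((mem_reroute_iff_of_none h).1 hy))
  | some u =>
    obtain ⟨⟨⟨c, z⟩, hu⟩, -, -⟩ := firstTerm_spec h
    rcases (mem_reroute_iff h).1 hy with hy | hy
    · exact absurd hyT (not_mem_T_of_mem_comp hy)
    · rcases (mem_tail_iff hu).1 hy with rfl | ⟨-, j, -, hp⟩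
      · exact ⟨u, rfl, rfl⟩
      · exact absurd hyT hp.left_mem.2

/-- **The tail of a term is `𝕋`-connected from its junction inside itself**: follow a path of the
term from a right site towards the junction up to its first visit of the junction; all sites
before are right. [cite: KestenSidoraviciusZhang1998, App. §7 (7.9) p. 27] -/
theorem pathIn_tail (hcut : Q.CutProp) {u : ℕ} {c : Finset (Site 2)} {z : Site 2}
    (hu : Q.lowestSeq ω u = some (c, z)) (hy : y ∈ τ.tail u) : PathIn triGraph (τ.tail u) (τ.jn u) y := by
  have hjn : τ.jn u ∈ τ.tail u := Set.mem_union_left _ rfl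
  rcases (mem_tail_iff hu).1 hy with rfl | ⟨hyc, hyr⟩
  · exact PathIn.refl hjn
  · have hc := (isCrossing_of_lowestSeq hu).1
    have hjc : τ.jn u ∈ c := (τ.jn_mem u c z hu).1
    obtain ⟨j, -, hpj⟩ := id hyr
    have hne : y ≠ τ.jn u := fun e => hpj.left_mem.2 (by rw [e]; exact (τ.jn_mem u c z hu).2)
    -- a path inside `c` from `y` to the junction, cut at its first visit of the junction
    obtain ⟨p, q, hpR, hqR, -, hpq, hpath⟩ :=
      (hc.conn y hyc (τ.jn u) hjc).exit (R := {w | w ≠ τ.jn u}) hne (fun h => h rfl)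
    have hq : q = τ.jn u := not_not.1 hqR
    subst hq
    obtain ⟨S, hSA, hS, hSall⟩ := hpath.exists_support
    have hS' : S ⊆ τ.tail u := by
      intro w hw
      have hwc : w ∈ c := Finset.mem_coe.1 (hSA hw).2
      have hwne : w ≠ τ.jn u := (hSA hw).1
      refine (mem_tail_iff hu).2 (Or.inr ⟨hwc, ?_⟩)
      have hpw : PathIn triGraph ((Q.D : Set (Site 2)) \ τ.T) y w :=
        (hSall w hw).mono fun v hv => τ.mem_sdiff_of_mem_term hcut hu (Finset.mem_coe.1 (hSA hv).2) (hSA hv).1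
      exact τ.isRight_of_pathIn hpw.symm hyr
    exact ((hS.mono hS').tail hpq hjn).symm

/-- **The rerouted member is `𝕋`-connected from its start inside itself.** [cite: KestenSidoraviciusZhang1998, App. §7 (7.9) p. 27] -/
theorem pathIn_reroute (hcut : Q.CutProp) (hy : y ∈ τ.reroute A a) : PathIn triGraph (τ.reroute A a) a y := by
  cases h : τ.firstTerm A a with
  | none =>
    rw [mem_reroute_iff_of_none h] at hy
    exact (pathIn_comp hy).mono comp_subset_reroute
  | some u =>
    obtain ⟨⟨⟨c, z⟩, hu⟩, -, x, hx, hxj⟩ := firstTerm_spec h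
    rcases (mem_reroute_iff h).1 hy with hy | hy
    · exact (pathIn_comp hy).mono comp_subset_reroute
    · have h1 : PathIn triGraph (τ.reroute A a) a (τ.jn u) :=
        ((pathIn_comp hx).mono comp_subset_reroute).tail hxj (jn_mem_reroute h)
      exact h1.trans ((pathIn_tail hcut hu hy).mono (tail_subset_reroute h))

/-! ### Left of `τ`: members entering `D` only through `F` -/

/-- **The first part of a member lies left of `τ`**: if the start `a` is off `D` and `A` enters
`D` only through `F`, every site of `comp A a` in `D` is joined to `F` inside `D ∖ T` (follow the
path from `a` and keep its part after its last entrance into `D`). [cite: KestenSidoraviciusZhang1998, App. §7 p. 27] -/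
theorem isLeft_of_mem_comp (haD : a ∉ Q.D)
    (hentry : ∀ p ∈ A, ∀ q, p ∉ Q.D → q ∈ Q.D → triGraph.Adj p q → q ∈ Q.F)
    (hx : x ∈ τ.comp A a) (hxD : x ∈ Q.D) : τ.IsLeft x := by
  obtain ⟨p, q, hpD, hpA, hqD, hpq, hpath⟩ :=
    PathIn.last_exit (C := {w | w ∉ Q.D}) hx haD (fun h => h hxD)
  have hqD' : q ∈ Q.D := not_not.1 hqD
  have hqF : q ∈ Q.F := hentry p hpA.1 q hpD hqD' hpq
  exact ⟨q, hqF, hpath.mono fun w hw => ⟨Finset.mem_coe.2 (not_not.1 hw.2), hw.1.2⟩⟩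

/-- **A member reaching the tip arc is rerouted** (it is open, `𝕋`-connected from a start off
`D`, and enters `D` only through `F`): its path to `J` crosses the transversal at an open site. [cite: KestenSidoraviciusZhang1998, App. §7 p. 27] -/
theorem firstTerm_ne_none_of_meets_J (hcut : Q.CutProp) (hAω : A ⊆ ω)
    (hconn : ∀ x ∈ A, PathIn triGraph A a x) (haD : a ∉ Q.D)
    (hentry : ∀ p ∈ A, ∀ q, p ∉ Q.D → q ∈ Q.D → triGraph.Adj p q → q ∈ Q.F)
    {j : Site 2} (hjA : j ∈ A) (hj : j ∈ Q.J) : τ.firstTerm A a ≠ none := by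
  have haT : a ∉ τ.T := fun h => haD (Finset.mem_coe.1 (τ.T_subset h))
  intro hnone
  -- then `A` misses `T`, so `j ∈ comp A a` is left of `τ`; but it is right of `τ`
  have hdisj : ∀ y ∈ A, y ∉ τ.T := fun y hy hyT => firstTerm_ne_none_of_mem hAω hconn haT hy hyT hnone
  have hjc : j ∈ τ.comp A a := (hconn j hjA).mono fun w hw => ⟨hw, hdisj w hw⟩
  have hl : τ.IsLeft j := isLeft_of_mem_comp haD hentry hjc (Q.J_subset hj)
  exact τ.not_isRight_of_isLeft hcut hl (τ.isRight_of_mem_J hj (hdisj j hjA))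

/-! ### KSZ (7.9): disjoint members are rerouted disjointly, onto distinct terms -/

/-- A site of the first part of one member is not in the tail chosen by a disjoint member. [cite: KestenSidoraviciusZhang1998, App. §7 p. 27] -/
theorem not_mem_tail_of_mem_comp (hcut : Q.CutProp) (hAB : Disjoint A B) (haD : a ∉ Q.D)
    (hentry : ∀ p ∈ A, ∀ q, p ∉ Q.D → q ∈ Q.D → triGraph.Adj p q → q ∈ Q.F)
    {u : ℕ} (hB : τ.firstTerm B b = some u) (hx : x ∈ τ.comp A a) : x ∉ τ.tail u := by
  obtain ⟨⟨⟨c, z⟩, hu⟩, hjB, -⟩ := firstTerm_spec hB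
  intro hxt
  rcases (mem_tail_iff hu).1 hxt with rfl | ⟨hxc, hxr⟩
  · exact Set.disjoint_left.1 hAB (comp_subset hx) hjB
  · have hxD : x ∈ Q.D := (isCrossing_of_lowestSeq hu).1.subset hxc
    exact τ.not_isRight_of_isLeft hcut (isLeft_of_mem_comp haD hentry hx hxD) hxr

/-- A site of a rerouted member lies in its first part or in the tail of its chosen term. [folklore] -/
theorem mem_reroute_cases (hx : x ∈ τ.reroute A a) :
    x ∈ τ.comp A a ∨ ∃ u, τ.firstTerm A a = some u ∧ x ∈ τ.tail u := by
  cases h : τ.firstTerm A a with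
  | none => exact Or.inl ((mem_reroute_iff_of_none h).1 hx)
  | some u => exact ((mem_reroute_iff h).1 hx).imp id fun h' => ⟨u, rfl, h'⟩

/-- **KSZ (7.9): the reroutings of two disjoint members are disjoint** (members open — only
through their chosen junctions —, starts off `D`, entering `D` only through `F`): first parts
are parts of the old members; a first part lies left of `τ`, a tail right of `τ` or on `T`; two
tails lie on distinct, hence disjoint, terms, since their junctions lie in the two members. [cite: KestenSidoraviciusZhang1998, App. §7 (7.9) p. 27] -/
theorem disjoint_reroute (hcut : Q.CutProp) (hAB : Disjoint A B) (haD : a ∉ Q.D) (hbD : b ∉ Q.D)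
    (hentryA : ∀ p ∈ A, ∀ q, p ∉ Q.D → q ∈ Q.D → triGraph.Adj p q → q ∈ Q.F)
    (hentryB : ∀ p ∈ B, ∀ q, p ∉ Q.D → q ∈ Q.D → triGraph.Adj p q → q ∈ Q.F) :
    Disjoint (τ.reroute A a) (τ.reroute B b) := by
  rw [Set.disjoint_left]
  intro x hxA hxB
  rcases mem_reroute_cases hxA with hxa | ⟨u, hu, hxa⟩ <;>
    rcases mem_reroute_cases hxB with hxb | ⟨u', hu', hxb⟩
  · exact Set.disjoint_left.1 hAB (comp_subset hxa) (comp_subset hxb)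
  · exact not_mem_tail_of_mem_comp hcut hAB haD hentryA hu' hxa hxb
  · exact not_mem_tail_of_mem_comp hcut hAB.symm hbD hentryB hu hxb hxa
  · -- two tails
    obtain ⟨⟨⟨c, z⟩, hcu⟩, hjA, -⟩ := firstTerm_spec hu
    obtain ⟨⟨⟨c', z'⟩, hcu'⟩, hjB, -⟩ := firstTerm_spec hu'
    have hne : u ≠ u' := by
      rintro rfl
      exact Set.disjoint_left.1 hAB hjA hjB
    have hdisj : Disjoint c c' := by
      rcases Nat.lt_or_gt_of_ne hne with hlt | hlt
      · exact lowestSeq_disjoint_of_lt hcut hlt hcu hcu'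
      · exact (lowestSeq_disjoint_of_lt hcut hlt hcu' hcu).symm
    exact Finset.disjoint_left.1 hdisj (Finset.mem_coe.1 (tail_subset_term hcu hxa))
      (Finset.mem_coe.1 (tail_subset_term hcu' hxb))

/-- **Disjoint members are rerouted onto distinct terms.** [cite: KestenSidoraviciusZhang1998, App. §7 (7.9) p. 27] -/
theorem firstTerm_ne_of_disjoint (hAB : Disjoint A B) {u u' : ℕ} (hu : τ.firstTerm A a = some u)
    (hu' : τ.firstTerm B b = some u') : u ≠ u' := by
  rintro rfl
  exact Set.disjoint_left.1 hAB (jn_mem_of_firstTerm hu) (jn_mem_of_firstTerm hu')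

end Transversal

end JDomain

/-! ### The trapezoid: sets of `Λ_{2M}` enter it only through its inner side -/

/-- **A set of sites of `Λ_{2M}` enters the trapezoid `trapD M` only through `trapI M`**: a site of
the trapezoid adjacent to a site of `Λ_{2M}` off the trapezoid lies on the inner side
`{v₀ = M + 1}` (the hypothesis `hentry` of `JDomain.Transversal.disjoint_reroute` for
`trapDomain M` and members inside `Λ_{2M}`). [cite: Nolin2008, §4.4 (arXiv 0711.4948: proof of Thm. 10, U-shaped regions)] -/
theorem mem_trapI_of_adj_not_mem {M : ℕ} {p q : Site 2} (hp : p ∉ trapD M) (hpn : triNorm p ≤ 2 * M)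
    (hq : q ∈ trapD M) (hpq : triGraph.Adj p q) : q ∈ trapI M := by
  rw [mem_trapI]
  refine ⟨hq, ?_⟩
  have hq' := mem_trapD.1 hq
  have hp0 : p 0 ≤ M := by
    by_contra h
    exact hp (mem_trapD_of_triNorm_le (by omega) hpn)
  have := triGraph_adj_coord hpq 0
  omega

/-- The entrance hypothesis for `trapDomain M` and a set of sites of `Λ_{2M}`. [folklore] -/
theorem trapDomain_entry {M : ℕ} {A : Set (Site 2)} (hA : ∀ v ∈ A, triNorm v ≤ 2 * M) :
    ∀ p ∈ A, ∀ q, p ∉ (trapDomain M).D → q ∈ (trapDomain M).D → triGraph.Adj p q → q ∈ (trapDomain M).F := by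
  intro p hp q hpD hqD hpq
  rw [trapDomain_D] at hpD hqD
  rw [trapDomain_F]
  exact mem_trapI_of_adj_not_mem hpD (hA p hp) hqD hpq

/-- A site of norm at most `M` is off the trapezoid. [folklore] -/
theorem not_mem_trapDomain_D_of_triNorm_le {M : ℕ} {a : Site 2} (ha : triNorm a ≤ M) : a ∉ (trapDomain M).D := by
  rw [trapDomain_D]
  intro h
  have h1 := (mem_trapD_iff_triNorm.1 h).1
  have h2 : a 0 ≤ triNorm a := le_trans (le_abs_self _) (abs_le_triNorm a).1
  omega

end Literature.Probability.Percolation
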